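import Literature.Probability.RandomPlanarGeometry.SAWStripTMGhost
import HarnessLib

/-!
# The invariant of the enriched strip transfer matrix, I: statement and `advance` (soundness, part 5)

Topic `Literature/Probability/RandomPlanarGeometry` (soundness of `SAWStripTM.lean`, part 5). The
invariant `Inv l r₀ cs u σ S` relating, at micro-time `u` of the run on the trace `cs`, the
signature `σ` of the executable automaton to the ghost strand family `S`:
well-formedness; swept cells only; **every real strand end is a frontier cell carrying the code
`stop m` with `m` its mate, and conversely**; `empty` frontier cells are unused; dummies are
`inter`; the virtual source/sink are present exactly when expected; the real edges are exactly the
grid edges chosen by the trace so far; the gap counters count (capped) the chosen horizontal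
edges. This file states it, proves it initially, and proves that `advance` preserves it.

## References

* I. Jensen, J. Phys. A 37 (2004) 11521–11529, §2.1.
* D. E. Knuth, TAOCP 4A (2011), §7.1.4.
-/

namespace Literature.Probability.RandomPlanarGeometry.SAW

namespace StripTM

variable {l r0 : ℕ}

/-! ### Unfolding the executable micro-steps -/

section Unfold

variable (l r0)

/-- `advance`, case `empty`/edge. [folklore] -/
theorem advance_empty_true {t : ℕ} {σ : State} (h : σ.slots[t % l]? = some .empty) :
    advance l r0 t σ true =
      if t % l + 1 = l ∧ σ.sink = false ∧ isStart l r0 t = false then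
        .next { σ with slots := σ.slots.set (t % l) (.stop .snk), sink := true }
      else .dead := by
  simp only [advance, h, Option.getD_some]

/-- `advance`, case `inter`/edge. [folklore] -/
theorem advance_inter_true {t : ℕ} {σ : State} (h : σ.slots[t % l]? = some .inter) :
    advance l r0 t σ true = .dead := by
  simp only [advance, h, Option.getD_some]

/-- `advance`, case `stop`/edge, not the start cell. [folklore] -/
theorem advance_stop_true {t : ℕ} {σ : State} {m : Mate} (h : σ.slots[t % l]? = some (.stop m))
    (hst : isStart l r0 t = false) : advance l r0 t σ true = .next σ := by
  simp only [advance, h, Option.getD_some, hst]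
  rfl

/-- `advance`, case `stop (col k)`/edge at the start cell. [folklore] -/
theorem advance_stop_true_start {t : ℕ} {σ : State} {k : ℕ} (h : σ.slots[t % l]? = some (.stop (.col k)))
    (hst : isStart l r0 t = true) :
    advance l r0 t σ true = .next { σ with slots := (σ.slots.set (t % l) .inter).set k (.stop .src) } := by
  simp only [advance, h, Option.getD_some, hst]
  rfl

/-- `advance`, case `stop src`/edge at the start cell. [folklore] -/
theorem advance_stop_src_true_start {t : ℕ} {σ : State} (h : σ.slots[t % l]? = some (.stop .src))
    (hst : isStart l r0 t = true) : advance l r0 t σ true = .dead := by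
  simp only [advance, h, Option.getD_some, hst]
  rfl

/-- `advance`, case `empty`/no edge. [folklore] -/
theorem advance_empty_false {t : ℕ} {σ : State} (h : σ.slots[t % l]? = some .empty) :
    advance l r0 t σ false =
      .next { σ with slots := σ.slots.set (t % l) (if isStart l r0 t then .stop .src else .empty) } := by
  simp only [advance, h, Option.getD_some]

/-- `advance`, case `inter`/no edge. [folklore] -/
theorem advance_inter_false {t : ℕ} {σ : State} (h : σ.slots[t % l]? = some .inter) :
    advance l r0 t σ false =
      .next { σ with slots := σ.slots.set (t % l) (if isStart l r0 t then .stop .src else .empty) } := by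
  simp only [advance, h, Option.getD_some]

/-- `advance`, case `stop (col k)`/no edge (the cell below becomes the sink). [folklore] -/
theorem advance_stop_col_false {t : ℕ} {σ : State} {k : ℕ} (h : σ.slots[t % l]? = some (.stop (.col k))) :
    advance l r0 t σ false =
      if t % l + 1 = l ∧ σ.sink = false then
        .next { σ with
          slots := (σ.slots.set k (.stop .snk)).set (t % l) (if isStart l r0 t then .stop .src else .empty)
          sink := true }
      else .dead := by
  simp only [advance, h, Option.getD_some]

/-- `advance`, case `stop snk`/no edge. [folklore] -/
theorem advance_stop_snk_false {t : ℕ} {σ : State} (h : σ.slots[t % l]? = some (.stop .snk)) :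
    advance l r0 t σ false = .dead := by
  simp only [advance, h, Option.getD_some]
  split_ifs <;> rfl

/-- `advance`, case `stop src`/no edge (completion or death). [folklore] -/
theorem advance_stop_src_false_ne_next {t : ℕ} {σ σ' : State} (h : σ.slots[t % l]? = some (.stop .src)) :
    advance l r0 t σ false ≠ .next σ' := by
  simp only [advance, h, Option.getD_some, completeIf]
  split_ifs <;> simp

end Unfold

/-! ### Unfolding the ghost `advance` -/

section UnfoldG

variable (l r0)

/-- `gAdvance`, case `empty`/edge. [folklore] -/
theorem gAdvance_empty_true {t : ℕ} {σ : State} (S : List (List XCell)) (h : σ.slots[t % l]? = some .empty) :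
    gAdvance l r0 t σ S true =
      merge (merge (S ++ [[below l t]] ++ [[cellOf l t]]) (below l t) (cellOf l t) ++ [[.vsnk]])
        (below l t) .vsnk := by
  simp only [gAdvance, h, Option.getD_some]

/-- `gAdvance`, case `stop`/edge. [folklore] -/
theorem gAdvance_stop_true {t : ℕ} {σ : State} (S : List (List XCell)) {m : Mate}
    (h : σ.slots[t % l]? = some (.stop m)) :
    gAdvance l r0 t σ S true =
      if isStart l r0 t then
        merge (merge (S ++ [[cellOf l t]]) (below l t) (cellOf l t) ++ [[.vsrc]]) (cellOf l t) .vsrc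
      else merge (S ++ [[cellOf l t]]) (below l t) (cellOf l t) := by
  simp only [gAdvance, h, Option.getD_some]

/-- `gAdvance`, case `empty`/no edge. [folklore] -/
theorem gAdvance_empty_false {t : ℕ} {σ : State} (S : List (List XCell)) (h : σ.slots[t % l]? = some .empty) :
    gAdvance l r0 t σ S false =
      if isStart l r0 t then merge (S ++ [[cellOf l t]] ++ [[.vsrc]]) (cellOf l t) .vsrc else S := by
  simp only [gAdvance, h, Option.getD_some]

/-- `gAdvance`, case `inter`/no edge. [folklore] -/
theorem gAdvance_inter_false {t : ℕ} {σ : State} (S : List (List XCell)) (h : σ.slots[t % l]? = some .inter) :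
    gAdvance l r0 t σ S false =
      if isStart l r0 t then merge (S ++ [[cellOf l t]] ++ [[.vsrc]]) (cellOf l t) .vsrc else S := by
  simp only [gAdvance, h, Option.getD_some]

/-- `gAdvance`, case `stop`/no edge. [folklore] -/
theorem gAdvance_stop_false {t : ℕ} {σ : State} (S : List (List XCell)) {m : Mate}
    (h : σ.slots[t % l]? = some (.stop m)) :
    gAdvance l r0 t σ S false =
      if isStart l r0 t then
        merge (merge (S ++ [[.vsnk]]) (below l t) .vsnk ++ [[cellOf l t]] ++ [[.vsrc]]) (cellOf l t) .vsrc
      else merge (S ++ [[.vsnk]]) (below l t) .vsnk := by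
  simp only [gAdvance, h, Option.getD_some]

end UnfoldG

/-! ### The invariant -/

/-- Number of horizontal edges chosen by the trace `cs` before micro-time `u` in column `c`
(i.e. across the gap `{c-1, c}`). [folklore] -/
def hcount (l : ℕ) (cs : List Bool) (u c : ℕ) : ℕ :=
  ((List.range u).filter fun u' => decide (u' % 2 = 1 ∧ u' / 2 % l = c ∧ cs.getD u' false = true)).length

/-- **The invariant** linking the signature `σ` at micro-time `u` of the run on the trace `cs` to
the ghost strand family `S`. [cite: Jensen2004SAWLowerBounds, §2.1] -/
structure Inv (l r0 : ℕ) (cs : List Bool) (u : ℕ) (σ : State) (S : List (List XCell)) : Prop where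
  /-- `l` frontier codes -/
  len_slots : σ.slots.length = l
  /-- `l - 1` gap counters -/
  len_gaps : σ.gaps.length = l - 1
  /-- mates are columns of the strip -/
  mate_lt : ∀ k j : ℕ, σ.slots[k]? = some (Code.stop (Mate.col j)) → j < l
  /-- the ghost family is well formed -/
  wf : WF (Adj l r0) S
  /-- no singleton strands -/
  two_le : ∀ π ∈ S, 2 ≤ π.length
  /-- strands consist of swept cells -/
  processed : ∀ x ∈ cells S, Processed l u x
  /-- real strand ends are exactly the coded frontier cells, with the coded mates -/
  ends : ∀ a b, a.IsReal → ((a, b) ∈ endPairs S ↔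
    ∃ k < l, ∃ m, σ.slots[k]? = some (Code.stop m) ∧ a = front l u k ∧ b = mateCell l u m)
  /-- `empty` frontier cells are unused -/
  empty : ∀ k < l, σ.slots[k]? = some Code.empty → front l u k ∉ cells S
  /-- frontier cells of the dummy row are `inter` -/
  dummy : ∀ k < l, ∀ c', front l u k = XCell.cell c' 0 → σ.slots[k]? = some Code.inter
  /-- the source is attached once the start cell is swept -/
  vsrc_mem : XCell.vsrc ∈ cells S ↔ 2 * (r0 * l) + 1 ≤ u
  /-- the sink is attached iff recorded -/
  vsnk_mem : XCell.vsnk ∈ cells S ↔ σ.sink = true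
  /-- the real edges are the chosen grid edges -/
  pairs_iff : ∀ p : Sym2 XCell, (p ∈ pairs S ∧ ∀ x ∈ p, x.IsReal) ↔
    ∃ u' < u, cs.getD u' false = true ∧ p = potEdge l u'
  /-- the gap counters -/
  gaps_eq : ∀ k, k + 1 < l → σ.gaps[k]? = some (min 2 (hcount l cs u (k + 1)))

/-! ### Consequences of the invariant -/

section Consequences

variable {cs : List Bool} {u : ℕ} {σ : State} {S : List (List XCell)}

/-- In a duplicate-free list of length `≥ 2` the first and last elements differ. [folklore] -/
theorem head?_ne_getLast? {π : List XCell} (hnd : π.Nodup) (h2 : 2 ≤ π.length) {a : XCell}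
    (hh : π.head? = some a) (hl : π.getLast? = some a) : False := by
  match π, hnd, h2, hh, hl with
  | x :: y :: t, hnd, _, hh, hl =>
    simp only [List.head?_cons, Option.some.injEq] at hh
    subst hh
    rw [List.getLast?_cons_cons] at hl
    exact (List.nodup_cons.1 hnd).1 (List.mem_of_getLast? hl)

/-- The two ends of a strand of a singleton-free family are distinct. [folklore] -/
theorem ne_of_mem_endPairs' (hW : WF (Adj l r0) S) (h2 : ∀ π ∈ S, 2 ≤ π.length) {a b : XCell}
    (h : (a, b) ∈ endPairs S) : a ≠ b := by
  obtain ⟨π, hπ, hp⟩ := mem_endPairs.1 h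
  rintro rfl
  rcases mem_epairs.1 hp with ⟨h1, h3⟩ | ⟨h1, h3⟩
  · exact head?_ne_getLast? (hW.nodup π hπ) (h2 π hπ) h1 h3
  · exact head?_ne_getLast? (hW.nodup π hπ) (h2 π hπ) h1 h3

/-- Under the invariant, a `stop`-coded frontier cell is in the family (hence swept, hence real
of row `≥ 1`). [folklore] -/
theorem Inv.front_mem_of_stop (hI : Inv l r0 cs u σ S) {k : ℕ} (hk : k < l) {m : Mate}
    (h : σ.slots[k]? = some (Code.stop m)) : front l u k ∈ cells S := by
  obtain ⟨r, hr⟩ := front_eq_cell (l := l) u k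
  have hreal : (front l u k).IsReal := by rw [hr]; trivial
  have := (hI.ends _ (mateCell l u m) hreal).2 ⟨k, hk, m, h, rfl, rfl⟩
  exact mem_cells_of_mem_endPairs this

/-- Under the invariant, the mate column of a `stop (col j)` code points into the family.
[folklore] -/
theorem Inv.front_mate_mem (hI : Inv l r0 cs u σ S) {k : ℕ} (hk : k < l) {j : ℕ}
    (h : σ.slots[k]? = some (Code.stop (Mate.col j))) : front l u j ∈ cells S := by
  obtain ⟨r, hr⟩ := front_eq_cell (l := l) u k
  have hreal : (front l u k).IsReal := by rw [hr]; trivial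
  have := (hI.ends _ _ hreal).2 ⟨k, hk, _, h, rfl, rfl⟩
  exact mem_cells_of_mem_endPairs (endPairs_symm this)

/-- Under the invariant, a `stop`-coded frontier cell has row `≥ 1`. [folklore] -/
theorem Inv.row_pos_of_stop (hI : Inv l r0 cs u σ S) {k : ℕ} (hk : k < l) {m : Mate}
    (h : σ.slots[k]? = some (Code.stop m)) {c r : ℕ} (hf : front l u k = XCell.cell c r) : 1 ≤ r := by
  have hmem := hI.front_mem_of_stop hk h
  rw [hf] at hmem
  exact one_le_of_processed (hI.processed _ hmem)

/-- No code points to a column whose frontier cell is unused. [folklore] -/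
theorem Inv.no_mate_of_not_mem (hI : Inv l r0 cs u σ S) {j : ℕ} (hj : front l u j ∉ cells S)
    {k : ℕ} (hk : k < l) : σ.slots[k]? ≠ some (Code.stop (Mate.col j)) := fun h => hj (hI.front_mate_mem hk h)

end Consequences

/-! ### The initial state -/

/-- The invariant holds initially. [folklore] -/
theorem inv_init (cs : List Bool) (hl : 1 ≤ l) : Inv l r0 cs 0 (initState l) [] := by
  refine ⟨by simp [initState], by simp [initState], ?_, WF.nil, by simp, by simp [cells], ?_, ?_, ?_, ?_, ?_, ?_, ?_⟩
  · intro k j h; simp [initState, List.getElem?_replicate] at h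
  · intro a b _
    simp only [endPairs, List.flatMap_nil, List.toFinset_nil, Finset.notMem_empty, false_iff, not_exists, not_and]
    intro k _ m h; simp [initState, List.getElem?_replicate] at h
  · intro k _ h; simp [initState, List.getElem?_replicate] at h
  · intro k hk c' _; simp [initState, hk]
  · simp [cells]
  · simp [cells, initState]
  · intro p; simp [pairs]
  · intro k hk
    simp only [initState, hcount, List.range_zero, List.filter_nil, List.length_nil]
    rw [List.getElem?_replicate, if_pos (by omega)]
    simp

end StripTM

end Literature.Probability.RandomPlanarGeometry.SAW
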